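import Mathlib
import HarnessLib
import Summits.ResolutionOfSingularities.ResolutionOfSingularities.Theorems.WildQuotientsWildQuotientResolutionStandardFormPClosed

/-!
# The JOINT KERNEL of the standard-form criterion: which tame elements must be standardised
# (crux `WildQuotients.WildQuotientResolution`, stub `stub_phaseZeroHighDim`; any embedding dimension)

Crux stmt-ResolutionOfSingularities-15640 (`WildQuotientResolution`), registered stub `stub_phaseZeroHighDim`.
✓`StandardForm.hasNormalSylow_of_tameFix_le_boundary` (p821673, the characteristic-`p` Reichstein–Youssin criterion)
asks that EVERY tame element `g ≠ 1` of the inertia group have its fixed locus in the strict stable boundary, and the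
all-dimensional engines built on it (✓`phaseZero_of_tameCores` p822635, ✓`phaseZero_of_orbitSeparation` p822889,
✓`phaseZero_of_primeOrbitSeparation` p822966) therefore ask the geometry to standardise EVERY tame element of every
non-p-closed subgroup. That is too much to ask: two distinct CONJUGATE COMMUTING cyclic tame subgroups `C`, `C' = gCg⁻¹`
(e.g. the two factors of the base of `C_ℓ ≀ C_2`, or `⟨(12)⟩, ⟨(34)⟩ ≤ S₄`) generate a tame ABELIAN group, whose fixed
points persist on every equivariant blow-up (an abelian group of order prime to `p` has an eigenline in every
representation), so their inert loci can never be separated, and no normal core lies below `(12)` — yet Phase 0 holds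
for `C₃ ≀ C₂` on `𝔸³` in characteristic `2` after ONE blow-up (of the inert locus of the anti-diagonal `C₃`).

This file extracts what the proof of p821673 really gives, so that the engines can be run with a WEAKER group-theoretic
hypothesis (companion file `…KernelCorePhaseZero`):

**Theorem** (`exists_lineCharacters`). For a residue-trivial action `τ` of `I` on a local ring `(R, 𝔪, κ)` of residue
characteristic `p` and boundary equations `z₁, …, z_r ∈ 𝔪 ∖ 𝔪²` spanning `I`-stable lines of `𝔪/𝔪²`, there is a
homomorphism `f : I → (κˣ)^r` (the line characters) such that NO element `g` of order prime to `p` with `f g i = 1`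
has `zᵢ ∈ 𝔞_{τ g} + 𝔪²`. Consequently (`exists_jointKernel`) the joint kernel `U = ker f` is a normal subgroup with
`I/U` abelian and without `p`-torsion (`[I, I] ≤ U`, every `p`-element of `I` lies in `U`), and no tame `u ∈ U`,
`u ≠ 1`, has its fixed locus in the boundary to first order. So only the tame elements of such a `U` — in
particular the tame COMMUTATORS (`not_mem_augIdeal_sup_of_mem_commutator`) — ever need standardising:
`hasNormalSylow_of_tameFix_le_boundary_of_kernel` is the criterion with the fixed-locus hypothesis asked only of a
set `S` of tame elements, plus the group-theoretic condition «every normal `U` with abelian `p`-torsion-free quotient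
avoiding `S` forces p-closedness»; p821673 is the case `S` = all tame elements.

[OURS · crux stmt-ResolutionOfSingularities-15640 · helper toward `stub_phaseZeroHighDim` (sharpening of the local
end-state criterion; NOT a proof of the stub); folklore local algebra, counted 0; AI-level work, weaker than expert
review.] [folklore]
-/

-- single-problem summit: the doubled namespace component `ResolutionOfSingularities` is forced
set_option linter.dupNamespace false

open IsLocalRing Literature.AlgebraicGeometry.Ramification Literature.AlgebraicGeometry.Resolution

namespace Summit.ResolutionOfSingularities.ResolutionOfSingularities.Theorems.WildQuotientResolution.StandardForm

/-! ## Group theory of a kernel with abelian `p`-torsion-free quotient -/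

section Group

variable {I : Type*} [Group I]

/-- Commutators lie in the kernel of a homomorphism to a commutative group. [folklore] -/
theorem commutatorElement_mem_ker {A : Type*} [CommGroup A] (f : I →* A) (a b : I) :
    a * b * a⁻¹ * b⁻¹ ∈ f.ker := by
  rw [MonoidHom.mem_ker, map_mul, map_mul, map_mul, map_inv, map_inv, mul_inv_cancel_comm, mul_inv_cancel]

/-- The commutator subgroup lies in the kernel of a homomorphism to a commutative group. [folklore] -/
theorem commutator_le_ker {A : Type*} [CommGroup A] (f : I →* A) : commutator I ≤ f.ker :=
  Abelianization.commutator_subset_ker f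

/-- If the target has no element of order `p`, the kernel is closed under `p`-th roots. [folklore] -/
theorem mem_ker_of_pow_mem_ker {A : Type*} [Group A] {p : ℕ} (hA : ∀ a : A, a ^ p = 1 → a = 1)
    (f : I →* A) {g : I} (hg : g ^ p ∈ f.ker) : g ∈ f.ker := by
  rw [MonoidHom.mem_ker] at hg ⊢
  exact hA _ (by rw [← map_pow, hg])

/-- If the target has no element of order `p`, every element of `p`-power order lies in the kernel. [folklore] -/
theorem mem_ker_of_pow_prime_pow_eq_one {A : Type*} [Group A] {p : ℕ} (hA : ∀ a : A, a ^ p = 1 → a = 1)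
    (f : I →* A) {g : I} {n : ℕ} (hg : g ^ p ^ n = 1) : g ∈ f.ker := by
  induction n generalizing g with
  | zero =>
    rw [pow_zero, pow_one] at hg
    rw [hg]
    exact one_mem _
  | succ n ih =>
    refine mem_ker_of_pow_mem_ker hA f (ih ?_)
    rw [← pow_mul, ← pow_succ', hg]

end Group

/-! ## The line characters and the joint kernel -/

section LocalRing

variable {R : Type*} [CommRing R] [IsLocalRing R] {I : Type*} [Group I]

/-- **The line characters of a strict stable boundary.** For a residue-trivial action `τ` of `I` on the local ring
`(R, 𝔪, κ)` of residue characteristic `p` and `z : Fin r → 𝔪 ∖ 𝔪²` with stable lines `κ z̄ᵢ`, there is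
`f : I →* (Fin r → κˣ)` (the scalars on the lines) such that an element `g` of order prime to `p` acting trivially on
the line `κ z̄ᵢ` (`f g i = 1`) never has `zᵢ ∈ 𝔞_{τ g} + 𝔪²`: a semisimple operator has no non-zero fixed vector in
its augmentation image (✓`mem_sq_of_mem_augIdeal_sup`). [folklore] -/
theorem exists_lineCharacters (p : ℕ) [Fact p.Prime] [CharP (ResidueField R) p] (τ : I →* (R ≃+* R))
    (hres : ∀ (g : I) (r : R), τ g r - r ∈ maximalIdeal R) {r : ℕ} (z : Fin r → R)
    (hz : ∀ i, z i ∈ maximalIdeal R) (hz2 : ∀ i, z i ∉ maximalIdeal R ^ 2)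
    (hstab : ∀ (g : I) (i : Fin r), τ g (z i) ∈ Ideal.span {z i} ⊔ maximalIdeal R ^ 2) :
    ∃ f : I →* (Fin r → (ResidueField R)ˣ), ∀ (g : I) (i : Fin r), (orderOf g).Coprime p → f g i = 1 →
      z i ∉ augIdeal (τ g) ⊔ maximalIdeal R ^ 2 := by
  choose ν hν using fun i => exists_character_of_stable_line τ hres (hz i) (fun g => hstab g i)
  refine ⟨MonoidHom.pi ν, fun g i hcop hgi hmem => hz2 i ?_⟩
  rw [MonoidHom.pi_apply] at hgi
  exact mem_sq_of_mem_augIdeal_sup p τ hres hcop hmem (hν i g hgi)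

/-- **The joint kernel.** Same data: there is a normal subgroup `U ⊴ I` containing all commutators and closed under
`p`-th roots (so `I/U` is abelian without `p`-torsion and `U` contains every `p`-element) such that no `u ∈ U` of
order prime to `p` has a boundary equation in `𝔞_{τ u} + 𝔪²` — the tame elements OUTSIDE `U` are irrelevant to
p-closedness. (`U` = the joint kernel of the line characters, `I/U ↪ (κˣ)^r`.) [folklore] -/
theorem exists_jointKernel (p : ℕ) [Fact p.Prime] [CharP (ResidueField R) p] (τ : I →* (R ≃+* R))
    (hres : ∀ (g : I) (r : R), τ g r - r ∈ maximalIdeal R) {r : ℕ} (z : Fin r → R)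
    (hz : ∀ i, z i ∈ maximalIdeal R) (hz2 : ∀ i, z i ∉ maximalIdeal R ^ 2)
    (hstab : ∀ (g : I) (i : Fin r), τ g (z i) ∈ Ideal.span {z i} ⊔ maximalIdeal R ^ 2) :
    ∃ U : Subgroup I, U.Normal ∧ (∀ a b : I, a * b * a⁻¹ * b⁻¹ ∈ U) ∧ (∀ g : I, g ^ p ∈ U → g ∈ U) ∧
      ∀ u ∈ U, (orderOf u).Coprime p → ∀ i, z i ∉ augIdeal (τ u) ⊔ maximalIdeal R ^ 2 := by
  obtain ⟨f, hf⟩ := exists_lineCharacters p τ hres z hz hz2 hstab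
  refine ⟨f.ker, inferInstance, commutatorElement_mem_ker f,
    fun g hg => mem_ker_of_pow_mem_ker (pi_units_eq_one_of_pow_char_eq_one p) f hg, fun u hu hcop i => ?_⟩
  exact hf u i hcop (by rw [MonoidHom.mem_ker.mp hu, Pi.one_apply])

/-- **A tame commutator is never standardised**: if `u ∈ [I, I]` has order prime to `p`, no boundary equation lies
in `𝔞_{τ u} + 𝔪²` (in particular `u ≠ 1` cannot have its fixed locus inside the strict stable boundary). [folklore] -/
theorem not_mem_augIdeal_sup_of_mem_commutator (p : ℕ) [Fact p.Prime] [CharP (ResidueField R) p]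
    (τ : I →* (R ≃+* R)) (hres : ∀ (g : I) (r : R), τ g r - r ∈ maximalIdeal R) {r : ℕ} (z : Fin r → R)
    (hz : ∀ i, z i ∈ maximalIdeal R) (hz2 : ∀ i, z i ∉ maximalIdeal R ^ 2)
    (hstab : ∀ (g : I) (i : Fin r), τ g (z i) ∈ Ideal.span {z i} ⊔ maximalIdeal R ^ 2)
    {u : I} (hu : u ∈ commutator I) (hcop : (orderOf u).Coprime p) (i : Fin r) :
    z i ∉ augIdeal (τ u) ⊔ maximalIdeal R ^ 2 := by
  obtain ⟨f, hf⟩ := exists_lineCharacters p τ hres z hz hz2 hstab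
  exact hf u i hcop (by rw [MonoidHom.mem_ker.mp (commutator_le_ker f hu), Pi.one_apply])

/-- **A tame element that is a product of `p`-elements and commutators is never standardised**: if `u` lies in the
subgroup generated by `[I, I]` and the elements of `p`-power order, and has order prime to `p`, then no boundary
equation lies in `𝔞_{τ u} + 𝔪²`. [folklore] -/
theorem not_mem_augIdeal_sup_of_mem_closure (p : ℕ) [Fact p.Prime] [CharP (ResidueField R) p]
    (τ : I →* (R ≃+* R)) (hres : ∀ (g : I) (r : R), τ g r - r ∈ maximalIdeal R) {r : ℕ} (z : Fin r → R)
    (hz : ∀ i, z i ∈ maximalIdeal R) (hz2 : ∀ i, z i ∉ maximalIdeal R ^ 2)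
    (hstab : ∀ (g : I) (i : Fin r), τ g (z i) ∈ Ideal.span {z i} ⊔ maximalIdeal R ^ 2)
    {u : I} (hu : u ∈ commutator I ⊔ Subgroup.closure {g : I | ∃ n : ℕ, g ^ p ^ n = 1})
    (hcop : (orderOf u).Coprime p) (i : Fin r) :
    z i ∉ augIdeal (τ u) ⊔ maximalIdeal R ^ 2 := by
  obtain ⟨f, hf⟩ := exists_lineCharacters p τ hres z hz hz2 hstab
  have hle : commutator I ⊔ Subgroup.closure {g : I | ∃ n : ℕ, g ^ p ^ n = 1} ≤ f.ker :=
    sup_le (commutator_le_ker f) ((Subgroup.closure_le _).mpr fun g ⟨n, hn⟩ =>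
      mem_ker_of_pow_prime_pow_eq_one (pi_units_eq_one_of_pow_char_eq_one p) f hn)
  exact hf u i hcop (by rw [MonoidHom.mem_ker.mp (hle hu), Pi.one_apply])

/-- **The standard-form criterion with a PARTIAL fixed-locus hypothesis** (crux stmt-ResolutionOfSingularities-15640,
toward `stub_phaseZeroHighDim`). Same data; let `S ⊆ I` be the set of elements whose fixed locus is known to lie in
the boundary to first order (`hfixS`). If every normal subgroup `U ⊴ I` containing the commutators, closed under
`p`-th roots, and containing no element of `S` of order prime to `p` forces `I` to be p-closed (`hgrp` — a purely
group-theoretic condition on `(I, S, p)`), then `I` has a normal Sylow `p`-subgroup. (✓p821673 is the case `S` = all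
tame elements `≠ 1`: then `U` is a `p`-group.) [folklore] -/
theorem hasNormalSylow_of_tameFix_le_boundary_of_kernel (p : ℕ) [Fact p.Prime] [CharP (ResidueField R) p]
    (τ : I →* (R ≃+* R)) (hres : ∀ (g : I) (r : R), τ g r - r ∈ maximalIdeal R) {r : ℕ} (z : Fin r → R)
    (hz : ∀ i, z i ∈ maximalIdeal R) (hz2 : ∀ i, z i ∉ maximalIdeal R ^ 2)
    (hstab : ∀ (g : I) (i : Fin r), τ g (z i) ∈ Ideal.span {z i} ⊔ maximalIdeal R ^ 2)
    (S : Set I) (hfixS : ∀ g ∈ S, ∃ i, z i ∈ augIdeal (τ g) ⊔ maximalIdeal R ^ 2)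
    (hgrp : ∀ U : Subgroup I, U.Normal → (∀ a b : I, a * b * a⁻¹ * b⁻¹ ∈ U) → (∀ g : I, g ^ p ∈ U → g ∈ U) →
      (∀ u ∈ U, (orderOf u).Coprime p → u ∉ S) → HasNormalSylow p I) :
    HasNormalSylow p I := by
  obtain ⟨U, hUn, hcomm, hroot, hU⟩ := exists_jointKernel p τ hres z hz hz2 hstab
  refine hgrp U hUn hcomm hroot fun u hu hcop huS => ?_
  obtain ⟨i, hi⟩ := hfixS u huS
  exact hU u hu hcop i hi

end LocalRing

end Summit.ResolutionOfSingularities.ResolutionOfSingularities.Theorems.WildQuotientResolution.StandardForm
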